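import Literature.MathematicalPhysics.QuantumFieldTheory.Balaban1983to89.B5Prop11Plancherel
import Literature.MathematicalPhysics.QuantumFieldTheory.King1986.TorusBlockForm

/-!
# `Balaban1983to89.B5Eq129FourierPrinted` — T. Bałaban, *Propagators and renormalization transformations for
# lattice gauge theories. I*, Commun. Math. Phys. **95** (1984) 17–40 [Balaban1984PropagatorsI], (1.29) p. 23:
# the Fourier transform of a torus WITH PRINT'S CONSTANTS — forward weight `η^d`, inverse weight
# `(2π)^{−d} Π_μ (π/L′_μ)` — and its inversion formula, PROVED

statement-level skeleton of published theorems with citation tags; proofs where landed; nothing here is a claim about the Yang–Mills mass gap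

CITATION HEADER (lean-in-tree rule).  Cell `lit-balaban`, unit `lit-balaban-r02` gen 50 (B5 fold owner), HOME
`run/shared/lean/pub/lit-balaban/`.  SKELETON row served: **B5.Eq1.29** ((1.29) p. 23 [PDF 7], kind DEF; head
`typed-existing` — the owner's READING-RULE audit `lit-balaban-r02/READING-RULE-AUDIT-B5-g50.md` §3.1 found that rule
(a) «numerical factors … as printed» FAILS for the row's declarations of record, the UNITARY transform
`B5Prop11Plancherel.dft` (*"(1.29) up to the constant normalisations η^d, (2π)^{-d} Π π/L′_μ, which do not affect
operator norms"*) and `B5Bounds167Lattice.hat`; this file is the owed member: print's pair of constants, verbatim, and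
the fact that it IS an inverse pair).  Page read FIRST-HAND as an image: render
`run/shared/lean/pub/pub-balaban/b2b-balaban-ref1/pages/1984-cmp95-propagators-rt-I/1984-cmp95-propagators-rt-I-p007-x2.png`.

WHAT IS PRINTED (verbatim, p. 23).  *"To understand better regularity properties and bounds of the operators involved we
write them in momentum representation. The momentum representation on an arbitrary torus
T′_η = {x ∈ ηℤ^d : −L′_μ ≦ x_μ < L′_μ, μ = 1, …, d} is introduced by the Fourier transform
  f̃(p) = Σ_{x∈T′_η} η^d e^{−ip·x} f(x),  p ∈ T̃′_η,
  f(x) = (2π)^{−d} Σ_{p∈T̃′_η} (Π_{μ=1}^{d} π/L′_μ) e^{ix·p} f̃(p),   (1.29)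
where T̃′_η is a dual torus T̃′_η = {p = (p₁, …, p_d) : p_μ = (π/L′_μ)n_μ, n_μ is an integer, −L′_μη⁻¹ ≦ n_μ < L′_μη⁻¹,
μ = 1, …, d}."*

DICTIONARY (print ↦ Lean).  `T′_η` ↦ the tree's torus `B5Prop11Plancherel.Tor N = Π_μ ZMod (N μ)` with `N μ = 2L′_μ/η`
sites in direction `μ`, a site `x` standing for the lattice point `η·j` (`j_μ` a representative of `x μ`), a momentum
`p` for `(π/L′_μ)·n_μ` (`n_μ` a representative of `p μ`) — so that `p·x = Σ_μ 2π n_μ j_μ / N_μ` and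
`e^{ip·x}` IS the tree's character `chi N p x = Π_μ e^{2πi p_μ x_μ/N_μ}` (representative-independent, since every summand
of (1.29) is `N_μ`-periodic in `n_μ` and in `j_μ`: print's half-open index ranges are ONE choice of representatives);
`L′_μ` ↦ `Lprime N η μ := η·N_μ/2`; `η > 0` (here only `η ≠ 0` is used).

WHAT THIS FILE PROVES (0 sorry, 0 `Prop`-valued definitions; definitions WITH BODY + theorems).
* `ft N η f p`  := `Σ_x η^d · conj (chi N p x) · f x`                       — the first display of (1.29), verbatim;
* `ift N η g x` := `Σ_p (2π)^{−d} · (Π_μ π/L′_μ) · chi N p x · g p`          — the second display of (1.29), verbatim;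
* (reused, not restated: `King1986.Torus.chi_comm`, `chi_neg_left`, `sum_chi_left` — orthogonality summed over momenta —
  already landed over the same carrier in `King1986/TorusBlockForm.lean`);
* `consts_mul_card` : `η^d · (2π)^{−d} Π_μ (π/L′_μ) · |T| = 1` — print's two constants multiply to `|T|^{−1} = Π_μ N_μ^{−1}`;
* **`ift_ft`** : `ift N η (ft N η f) = f` — THE INVERSION FORMULA (1.29) with print's constants, for every `f : T → ℂ`;
* `ft_eq_smul_dft` : `ft N η f p = (η^d · |T|^{1/2}) · (dft N *ᵥ f) p` — the dictionary to the unitary transform of record.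

HONEST SCOPE.  (i) Carrier = the finite torus `Π_μ ℤ/N_μ` (any `N_μ ≥ 1`); print's `N_μ = 2L′_μη^{−1}` is even — not
needed and not assumed; `L′_μ` is DEFINED from `(N, η)`.  (ii) The phase `p·x` is realised through the `ZMod`
characters (above); no embedding of the torus in `ηℤ^d` is used.  (iii) Only the transform pair and its inversion are
claimed — Plancherel/unitarity and every momentum-space formula of the paper ((1.30)–(1.37), (1.63), (1.66)–(1.67),
(1.81)–(1.83)) remain on the unitary `dft` (rows B5.Eq1.31/1.34/1.36/1.66/1.67/1.81/1.83), reachable through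
`ft_eq_smul_dft`.  Value = the printed constants recorded in the kernel with the one-line check that they invert each
other; NOT summit progress.
-/

open scoped BigOperators ComplexConjugate Matrix
open Finset Complex

namespace Literature.MathematicalPhysics.QuantumFieldTheory.Balaban1983to89.B5Eq129FourierPrinted

open B5Prop11Plancherel (Tor chi dft conj_chi chi_add_right chi_neg_neg chi_zero_left sum_chi)
open King1986.Torus (chi_comm chi_neg_left sum_chi_left)

noncomputable section

variable {d : ℕ} (N : Fin d → ℕ) [hN : ∀ μ, NeZero (N μ)] (η : ℝ)

/-- `L′_μ`: half the period of the torus in direction `μ`, `L′_μ = η N_μ / 2` (print: `N_μ = 2L′_μη^{−1}` sites,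
`−L′_μ ≦ x_μ < L′_μ`). [cite: Balaban1984PropagatorsI, (1.29) p.23] -/
def Lprime (μ : Fin d) : ℝ := η * (N μ : ℝ) / 2

/-- the forward constant of (1.29): `η^d`. [cite: Balaban1984PropagatorsI, (1.29) p.23] -/
def cFwd : ℂ := ((η ^ d : ℝ) : ℂ)

/-- the inverse constant of (1.29): `(2π)^{−d} Π_{μ=1}^{d} π/L′_μ`. [cite: Balaban1984PropagatorsI, (1.29) p.23] -/
def cInv : ℂ := ((((2 * Real.pi) ^ d)⁻¹ * ∏ μ, Real.pi / Lprime N η μ : ℝ) : ℂ)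

/-- **(1.29), first display, verbatim**: `f̃(p) = Σ_{x∈T′_η} η^d e^{−ip·x} f(x)`, `p ∈ T̃′_η`
(`e^{−ip·x} = conj (chi N p x)`). [cite: Balaban1984PropagatorsI, (1.29) p.23] -/
def ft (f : Tor N → ℂ) (p : Tor N) : ℂ := ∑ x : Tor N, cFwd η (d := d) * conj (chi N p x) * f x

/-- **(1.29), second display, verbatim**: `f(x) = (2π)^{−d} Σ_{p∈T̃′_η} (Π_μ π/L′_μ) e^{ix·p} f̃(p)`.
[cite: Balaban1984PropagatorsI, (1.29) p.23] -/
def ift (g : Tor N → ℂ) (x : Tor N) : ℂ := ∑ p : Tor N, cInv N η * chi N p x * g p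

/-- `|T| = Π_μ N_μ`. [cite: Balaban1984PropagatorsI, (1.29) p.23] -/
theorem card_tor : Fintype.card (Tor N) = ∏ μ, N μ := by
  rw [Fintype.card_pi]
  exact Finset.prod_congr rfl fun μ _ => ZMod.card (N μ)

/-- **print's constants invert each other**: `η^d · ((2π)^{−d} Π_μ π/L′_μ) · |T| = 1`
(`Π_μ π/L′_μ = Π_μ 2π/(ηN_μ) = (2π)^d η^{−d} |T|^{−1}`). [cite: Balaban1984PropagatorsI, (1.29) p.23] -/
theorem consts_mul_card (hη : η ≠ 0) :
    cFwd η (d := d) * cInv N η * (Fintype.card (Tor N) : ℂ) = 1 := by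
  have hNpos : ∀ μ, (0 : ℝ) < (N μ : ℝ) := fun μ => Nat.cast_pos.mpr (Nat.pos_of_ne_zero (NeZero.ne (N μ)))
  have hfac : ∀ μ, Real.pi / Lprime N η μ = (2 * Real.pi) * (η * (N μ : ℝ))⁻¹ := by
    intro μ
    unfold Lprime
    have h1 : (η * (N μ : ℝ)) ≠ 0 := mul_ne_zero hη (hNpos μ).ne'
    field_simp
  have hprod : (∏ μ, Real.pi / Lprime N η μ) = (2 * Real.pi) ^ d * (η ^ d * ∏ μ, (N μ : ℝ))⁻¹ := by
    simp_rw [hfac]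
    rw [Finset.prod_mul_distrib, Finset.prod_const, Finset.card_univ, Fintype.card_fin, Finset.prod_inv_distrib,
      Finset.prod_mul_distrib, Finset.prod_const, Finset.card_univ, Fintype.card_fin, mul_inv]
  have hcardR : ((Fintype.card (Tor N) : ℕ) : ℝ) = ∏ μ, (N μ : ℝ) := by
    rw [card_tor N]; push_cast; rfl
  have hP : (∏ μ, (N μ : ℝ)) ≠ 0 := Finset.prod_ne_zero_iff.mpr fun μ _ => (hNpos μ).ne'
  have h2pi : ((2 * Real.pi) ^ d : ℝ) ≠ 0 := pow_ne_zero _ (mul_ne_zero two_ne_zero Real.pi_pos.ne')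
  have hηd : (η ^ d : ℝ) ≠ 0 := pow_ne_zero _ hη
  -- everything is a real number cast to ℂ
  have : ((η ^ d : ℝ) : ℂ) * ((((2 * Real.pi) ^ d)⁻¹ * ∏ μ, Real.pi / Lprime N η μ : ℝ) : ℂ)
      * (((Fintype.card (Tor N) : ℕ) : ℝ) : ℂ) = ((1 : ℝ) : ℂ) := by
    rw [← Complex.ofReal_mul, ← Complex.ofReal_mul]
    congr 1
    rw [hprod, hcardR]
    field_simp
  simpa [cFwd, cInv] using this

/-- **THE INVERSION FORMULA (1.29) with print's constants**: `f(x) = (2π)^{−d} Σ_p (Π_μ π/L′_μ) e^{ix·p} f̃(p)` for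
`f̃(p) = Σ_x η^d e^{−ip·x} f(x)` — for EVERY `f : T′_η → ℂ` (`η ≠ 0`). [cite: Balaban1984PropagatorsI, (1.29) p.23] -/
theorem ift_ft (hη : η ≠ 0) (f : Tor N → ℂ) : ift N η (ft N η f) = f := by
  classical
  funext x
  unfold ift ft
  -- expand, swap the sums, collect the constants
  have hstep : ∀ p y : Tor N, cInv N η * chi N p x * (cFwd η (d := d) * conj (chi N p y) * f y)
      = (cFwd η (d := d) * cInv N η) * f y * chi N p (x - y) := by
    intro p y
    rw [conj_chi, chi_neg_left, sub_eq_add_neg, chi_add_right]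
    ring
  simp_rw [Finset.mul_sum, hstep]
  rw [Finset.sum_comm]
  simp_rw [← Finset.mul_sum, sum_chi_left N]
  -- only `y = x` survives
  rw [Finset.sum_eq_single x]
  · rw [sub_self, if_pos rfl]
    calc cFwd η (d := d) * cInv N η * f x * (Fintype.card (Tor N) : ℂ)
        = (cFwd η (d := d) * cInv N η * (Fintype.card (Tor N) : ℂ)) * f x := by ring
      _ = f x := by rw [consts_mul_card N η hη, one_mul]
  · intro y _ hy
    rw [if_neg (sub_ne_zero.mpr (Ne.symm hy)), mul_zero]
  · intro h; exact absurd (Finset.mem_univ x) h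

/-- DICTIONARY to the transform of record: `f̃ = (η^d·|T|^{1/2}) · F f` for the unitary DFT matrix
`F = B5Prop11Plancherel.dft N` (`F_{p,x} = |T|^{−1/2} e^{−ip·x}`). [cite: Balaban1984PropagatorsI, (1.29) p.23] -/
theorem ft_eq_smul_dft (f : Tor N → ℂ) (p : Tor N) :
    ft N η f p = cFwd η (d := d) * (Real.sqrt (Fintype.card (Tor N)) : ℂ) * (dft N *ᵥ f) p := by
  classical
  have hc : (0 : ℝ) < Fintype.card (Tor N) := by exact_mod_cast Fintype.card_pos
  have hs : (Real.sqrt (Fintype.card (Tor N)) : ℂ) ≠ 0 := by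
    exact_mod_cast (Real.sqrt_pos.mpr hc).ne'
  have hss : (Real.sqrt (Fintype.card (Tor N)) : ℂ) * (((Real.sqrt (Fintype.card (Tor N)))⁻¹ : ℝ) : ℂ) = 1 := by
    rw [Complex.ofReal_inv, mul_inv_cancel₀ hs]
  simp only [ft, Matrix.mulVec, dotProduct, dft, Finset.mul_sum]
  refine Finset.sum_congr rfl fun x _ => ?_
  calc cFwd η (d := d) * conj (chi N p x) * f x
      = cFwd η (d := d) * ((Real.sqrt (Fintype.card (Tor N)) : ℂ)
          * (((Real.sqrt (Fintype.card (Tor N)))⁻¹ : ℝ) : ℂ)) * conj (chi N p x) * f x := by rw [hss, mul_one]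
    _ = cFwd η (d := d) * (Real.sqrt (Fintype.card (Tor N)) : ℂ)
          * ((((Real.sqrt (Fintype.card (Tor N)))⁻¹ : ℝ) : ℂ) * conj (chi N p x) * f x) := by ring

end

end Literature.MathematicalPhysics.QuantumFieldTheory.Balaban1983to89.B5Eq129FourierPrinted
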